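import Literature.MathematicalPhysics.QuantumFieldTheory.Balaban1983to89.B2Eq265PrintedForm
import Literature.MathematicalPhysics.QuantumFieldTheory.Balaban1983to89.B2Eq28RegionsCollars
import Literature.MathematicalPhysics.QuantumFieldTheory.Balaban1983to89.B2Eq28RegionsBigBlockUnion
import Literature.MathematicalPhysics.QuantumFieldTheory.Balaban1983to89.B2Eq267HiggsRegion

/-!
# `Balaban1983to89.B2Eq265HiggsTower` — [Balaban1982Higgs2] Lemma 2.4 (2.65) p.572, value clause «under the restrictions (2.55)», ON THE
# (Higgs)₂,₃ CARRIER OF RECORD FOR PRINT'S OWN REGIONS: `Λ₂^{(k−1)′} ⊇ Λ₆^{(k−1)′}` of (2.56) p.570 «φ^{(k)} = a_kG_k(Bᵏ(Λ₂^{(k−1)′}),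
# A^{(k)})Q_k^*(A^{(k)})Λ₆^{(k−1)′}φ» and `Λ₋₁^{(k−1)′}` of (2.55) («for x ∈ Λ₋₁^{(k−1)′}, b ⊂ Λ₋₁^{(k−1)′}») = the typer's (2.7)–(2.8)/(2.43)
# tower `prime (towerRegion bad rad j i)` of step `j = k − 1` with `Λ₋₁ :=` the «additional thickness r» neighbourhood
# `(near Λ₀^{(j)} r(Lʲε))′` (p.558), cube size `K₀ = M` — so that `Λ₆′ ⊆ Λ₂′`, «Bᵏ(Λ₂′) a big-block union» and the (2.8)-cube
# condition into `Λ₋₁′` of F12/F13 are DERIVED from the tower's collars (`eq265_higgs_tower`)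

statement-level skeleton of published theorems with citation tags; proofs where landed; nothing here is a claim
about the Yang–Mills mass gap

PDF held: `paper:balaban1982-cmp86-higgs23-ii` (journal page = PDF page + 554), p. 572 [PDF 18] (Lemma 2.4), p. 570 [PDF 16] ((2.55)/(2.56)),
p. 558 [PDF 4] ((2.7)–(2.8): «Λ_{i+1}ᶜ is the sum of all large blocks of T₁ with distances from the set Λ_iᶜ less or equal r(ε)» and «Let us
denote by Λ^{(*,′)}_{−1} the set of the points (the bonds, the blocks) in T₁ distant from Λ₀ less than r(ε)»), p. 566 [PDF 12] ((2.43)).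

CITATION HEADER (lean-in-tree rule).  T. Bałaban, *(Higgs)₂,₃ quantum fields in a finite volume. II. An upper bound*,
Commun. Math. Phys. **86** (1982) 555–594, doi:10.1007/bf01214890 [Balaban1982Higgs2].  Cell `lit-balaban` (HOME
`run/shared/lean/pub/lit-balaban/`), Phase-2 proof seat **p23** gen 22 (unit `lit-balaban-p23-g22`; free-target protocol G.5-34(d), TAKING #7
line HOME/STATUS.md 2026-08-23); SKELETON row **B2.Lem2.4** (fold owner r02, second reader r14; head `proved p250408 · …` UNCHANGED —
cells-only member, brick F14).  USED BY NAME, never restated: own F13 `B2Eq265PrintedForm.eq265_higgs_region_tails`; the typer's tower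
`B2Eq243RegionsTower.towerRegion`, `B2Eq324NestedRegions.prime`, `B2Eq28RegionsConcrete.near`; own gen-13 `B2Eq28RegionsCollars.
nbhd_towerRegion` (the (2.8) collars in block-label form), own gen-17 `B2Eq28RegionsBigBlockUnion.isBigBlockUnion_towerRegion_prime`,
own gen-20 `B2Eq267HiggsRegion.prime_towerRegion_six_subset_two`; p15's `B2Ineq329BlockPoincare.blockIter_toFinest`.

THE ARGUMENT.  F13's `eq265_higgs_region_tails` holds for arbitrary coarse regions `Λ₋₁, Λ₂ ⊇ Λ₆` with `Bᵏ(Λ₂)` a big-block union of cube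
size `K₀ ∣ M` and the cube condition «`y ∈ Λ₂`, `|y − y′| ≤ R_n` ⇒ `y′ ∈ Λ₋₁`».  For print's regions of step `j`, primed to
`T^{(k)} = T^{(j+1)}`: `Λ₆^{(j)′} ⊆ Λ₂^{(j)′}` is the tower's monotonicity ((2.8) «Λ_{i+1} ⊂ Λ_i»); `Bᵏ(Λ₂^{(j)′})` is a big-block union with
cube size exactly `M`; and two (2.8)-collars plus the «additional thickness r(Lʲε)» put every `k`-site `y′` within `R_n` of a site
`y ∈ Λ₂^{(j)′}` into `(near Λ₀^{(j)} r(Lʲε))′ ⊆ Λ₋₁^{(j)′}` as soon as the room condition `L(R_n + 1) − 1 ≤ 3n` holds for some integer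
`n < r(Lʲε)` (`nbhd_towerRegion` at the fine point `ỹ` over `y`).  So (2.65) holds with `K₀ := M` («M sufficiently large»), the three
hypotheses discharged.

WHAT THIS FILE PROVES (kernel-checked, zero `sorry`; theorems only — NO definition, NO `Prop`-valued fact; axioms standard).
 **`eq265_higgs_tower`** — F13's `eq265_higgs_region_tails` word for word except (located edits): `K₀min/K₀` ↦ `Mmin/M` with
 `K₀ ∣ P.M` ↦ `P.M = M`; level `k` ↦ `j + 1` (`1 ≤ k` dropped, `k ≤ K` ↦ `j + 1 ≤ K`); the region binders `(Λ₂ Λ₆ …)`, `Λ₆ ⊆ Λ₂`,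
 `IsBigBlockUnion k K₀ (Bᵏ(Λ₂))`, `Λ₋₁` REPLACED by the tower data `(bad) (rad), 0 < rad j` with `Λ₂ := (Λ₂^{(j)})′`, `Λ₆ := (Λ₆^{(j)})′`,
 `Λ₋₁ := (near Λ₀^{(j)} (rad j))′` at every occurrence; the cube condition REPLACED by the room condition `(n : ℕ), n < rad j →
 L(R_n + 1) − 1 ≤ 3n →`.  The bound is F13's with `K₀ ↦ M`, `k ↦ j + 1`.

HONEST SCOPE / DIFFERENCES FROM PRINT (recorded, not hidden; one sentence each).  (a) STILL HYPOTHESES: `□₂ ⊆ Λ₂^{(j)′}` and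
`□₁ ⊆ Λ₆^{(j)′}` — print's `□₁, □₂` are «the sums of large blocks CONTAINED IN Λ₇^{(k−1)′}» within `2r`, `4r` of `y`, hence inside
`Λ₇′ ⊆ Λ₆′ ⊆ Λ₂′` by construction, whereas here `□₂` must be a full box (the cell-box Neumann machinery) and `□₁` the full cube about `ȳ`:
for `y` deep inside `Λ₇′` the two agree, in the collar of `∂Λ₇′` they do not (GAPS G-B2-p23-01 reading, unchanged); `Bᵏ(□₂)` a cell box of
cube size `M` stays a hypothesis too.  (b) The ROOM CONDITION `L(R_n + 1) − 1 ≤ 3n`, `n < r(Lʲε)`, with `ρ + 1 ≤ R_n`, is the cell's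
reading (c) of GAPS G-B2-12 (`ρ_k = 3r(L^{k−1}ε)/L − 2M − 2`, own `B2Eq28RegionsCollars` §5): print's (2.44) radius `r(Lᵏε) − 2M` does
not fit inside three (2.8)-collars for `L ≥ 4`.  (c) `Λ₋₁` is instantiated at the POINT part `(near Λ₀^{(j)} r(Lʲε))′` of print's
`Λ^{(*,′)}_{−1}` («the points (the bonds, the blocks) … distant from Λ₀ less than r(ε)»).  (d) Which sites are large-field (`bad`) and the
radius function `rad` (print: `r(Lʲε) = R(1 + log (Lʲε)⁻¹)^r`, (2.7)) are data.  (e) Everything else as in F13's/F12's HONEST SCOPE (value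
clause only; torus sub-family `Shape P`, odd `L > 1`, here with `P.M = M`; zero external field in (2.54); general (2.55) letters — the
printed instance is F13's `eq265_higgs_region_printed255`; base point the corner; readings of the radii; nothing minted).  NOT summit
progress.  (f) NOTHING MINTED: `Mmin` is F13's `K₀min` (the chain F5 → F9 → F12 → F13), `e₁, t, C₁ … D₄` F13's, `δ, C_V, C_F` Lemma 2.3's.
-/

open scoped BigOperators

noncomputable section

namespace Literature.MathematicalPhysics.QuantumFieldTheory.Balaban1983to89.B2Eq265HiggsTower

open HiggsLattice (ChargeData)
open HiggsAveraging (blockIter toFinest)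
open HiggsCovariance (avgQkAdj)
open B2Eq255Concrete (bgScalar256 underRegion mem_underRegion Restr255 Restr255Printed)
open B2Eq265PrintedForm (eq265_higgs_region_tails)
open B2Eq324NestedRegions (prime)
open B2Eq243RegionsTower (towerRegion)
open B2Eq28RegionsConcrete (near)
open B2Eq28RegionsCollars (nbhd_towerRegion)
open B2Eq28RegionsBigBlockUnion (isBigBlockUnion_towerRegion_prime)
open B2Eq267HiggsRegion (prime_towerRegion_six_subset_two)
open B2Ineq329BlockPoincare (blockIter_toFinest)
open B2Lemma23HiggsLattice (cutMin)
open B1Eq211ZeroFieldTorus (Shape)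
open B3MultiscaleFields (toSite ofSite)
open B1Ineq225RegularBox (cellBox)
open B1TorusRegionHSizes (IsBigBlockUnion)
open B1TorusCubeCover (half)
open B1TorusCubeLocality26 (rS)

variable {P : HiggsLattice.Params}

/-! ## (2.65) for print's own regions -/

section Tower

/-- **LEMMA 2.4 (2.65), VALUE CLAUSE, «UNDER THE RESTRICTIONS (2.55)», FOR PRINT'S OWN REGIONS `Λ₂^{(k−1)′} ⊇ Λ₆^{(k−1)′}`,
`Λ₋₁^{(k−1)′} ⊇ (near Λ₀^{(k−1)} r)′`, cube size `K₀ = M`.**  TYPED vs PRINTED: F13's `B2Eq265PrintedForm.eq265_higgs_region_tails` word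
for word except the located edits: `∃ K₀min ∀ K₀ ≥ K₀min … K₀ ∣ P.M` ↦ `∃ Mmin ∀ M ≥ Mmin … P.M = M` («M sufficiently large»); level
`k` ↦ `j + 1`; the binders `(Λ₂ Λ₆ …)`, `Λ₆ ⊆ Λ₂ →`, `IsBigBlockUnion k K₀ (underRegion k Λ₂) →` and `(Λm1 …)` ↦ the tower data
`(bad) (rad), 0 < rad j →` with `Λ₂ := prime (towerRegion bad rad j 2)`, `Λ₆ := prime (towerRegion bad rad j 6)`,
`Λm1 := prime (near (towerRegion bad rad j 0) (rad j))` substituted; the cube condition `(∀ y ∈ Λ₂, ∀ y′, |y − y′| ≤ R_n → y′ ∈ Λm1) →` ↦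
`∀ (n : ℕ), n < rad j → L(R_n + 1) − 1 ≤ 3n →`.  The bound is F13's with `K₀ ↦ M`, `k ↦ j + 1`; `Mmin` IS F13's `K₀min` and
`e₁, t, C₁ … D₄, δ, C_V, C_F` are F13's — nothing is minted here.
[cite: Balaban1982Higgs2, Lemma 2.4 (2.65) p.572] [cite: Balaban1982Higgs2, (2.56) p.570, (2.55) p.570, (2.7)–(2.8) p.558, (2.43) p.566]
[cite: Balaban1982Higgs2, Lemma 2.4 proof p.572 «Let us define □₁, □₂ as the sums of large blocks contained in Λ₇^{(k−1)′} and distant from the point y less than 2r(Lᵏε), 4r(Lᵏε) respectively, and let us denote □ = Bᵏ(□₂). Of course □ ⊂ Bᵏ(Λ₂^{(k−1)′}).»]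
[cite: Balaban1982Higgs1, Prop. 2.1 p.610 «let Ω^{(k)} ⊂ T^{(k)}_1 be a sum of big blocks with M sufficiently large»] -/
theorem eq265_higgs_tower (d L : ℕ) (hd : 1 ≤ d) (hL : Odd L ∧ 1 < L) {a : ℝ} (ha : 0 < a) {msq : ℝ} (hmsq : 0 < msq)
    {aV : ℝ} (haV : 0 < aV) {mu0sq : ℝ} (hmu0 : 0 < mu0sq)
    (N : ℕ) (C : ChargeData N) (ε₀ : ℝ) (creg β : ℝ) (hcreg : 0 ≤ creg) (hβ : 0 < β) :
    ∃ δ CV CF : ℝ, 0 < δ ∧ 0 < CV ∧ 0 < CF ∧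
    ∃ Mmin : ℕ, ∀ M : ℕ, Mmin ≤ M → ∃ e₁ t : ℝ, 0 < e₁ ∧ 0 < t ∧
      ∃ C₁ C₂ C₃ D₁ D₂ D₃ D₄ : ℝ, 0 ≤ C₁ ∧ 0 ≤ C₂ ∧ 0 ≤ C₃ ∧ 0 ≤ D₁ ∧ 0 ≤ D₂ ∧ 0 ≤ D₃ ∧ 0 ≤ D₄ ∧
      ∀ (P : HiggsLattice.Params) (_ : Shape P), P.d = d → P.L = L → P.M = M →
      ∀ {j : ℕ}, j + 1 ≤ P.K → (∀ μ, 3 * half P (j + 1) M ≤ P.sitesPerDir 0 μ) → P.mesh (j + 1) ≤ ε₀ → P.mesh (j + 1) ≤ 1 →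
      -- PRINT'S OWN REGIONS: the (2.7)–(2.8)/(2.43) tower of step `j`, primed to `T^{(k)}`, `k = j + 1`; `Λ₂′ ⊇ □₂`, `Λ₆′ ⊇ □₁`
      ∀ (bad : (l : ℕ) → Set (HiggsLattice.Site P l)) (rad : ℕ → ℝ), 0 < rad j →
      ∀ (sq₂ sq₁ : Finset (HiggsLattice.Site P (j + 1))) (S : Fin P.d → Finset ℕ) (q : HiggsLattice.Site P (j + 1)) (Sbox : ℕ),
        sq₂ ⊆ prime (towerRegion bad rad j 2) → sq₁ ⊆ prime (towerRegion bad rad j 6) →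
        underRegion (j + 1) sq₂ = cellBox (j + 1) M S →
        (∀ μ : Fin P.d, P.L ^ (j + 1) * Sbox < P.sitesPerDir 0 μ) →
      -- `□₂` IS the box `q + [0,S)ᵈ` of coarse sites, `□ = B^k(□₂)` smaller than half the torus
        (∀ y : HiggsLattice.Site P (j + 1), y ∈ sq₂ ↔ ∀ ν : Fin P.d, (y ν - q ν).val < Sbox) →
        (∀ μ : Fin P.d, 2 * (P.L ^ (j + 1) * Sbox) ≤ P.sitesPerDir 0 μ) →
      -- `□₁` is the box of coarse sites of radius `R₁` (corner `q₁`); `m ≥ R₁` a coarse margin with `Lᵏm ≥` the depth radius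
      ∀ (q₁ : HiggsLattice.Site P (j + 1)) (R₁ m : ℕ), R₁ ≤ m → 2 * rS P (j + 1) M + 2 * half P (j + 1) M * (P.d + 1) + 1 ≤ P.L ^ (j + 1) * m →
        (∀ y : HiggsLattice.Site P (j + 1), y ∈ sq₁ ↔ ∀ ν : Fin P.d, (y ν - q₁ ν).val < 2 * R₁ + 1) →
      -- the cutoff `ζ^{(k)}` of (2.44)
      ∀ (ζ : HiggsLattice.Site P 0 → HiggsLattice.Site P (j + 1) → ℝ) (ρ ρ₁ : ℝ), 0 ≤ ρ₁ →
        (∀ x y', |ζ x y'| ≤ 1) →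
        (∀ x y', ζ x y' ≠ 0 → (HiggsLattice.Site.tdist (blockIter (j + 1) x) y' : ℝ) ≤ ρ) →
        (∀ x y', (HiggsLattice.Site.tdist (blockIter (j + 1) x) y' : ℝ) ≤ ρ₁ → ζ x y' = 1) →
        (∀ (x : HiggsLattice.Site P 0) (ν : Fin P.d) (y' : HiggsLattice.Site P (j + 1)), |ζ (x.shift ν) y' - ζ x y'| ≤ ((P.L : ℝ) ^ (j + 1))⁻¹) →
      -- the cube of radius `R_n ≥ ρ + 1` about `y ∈ Λ₂′` lies in `Λ₋₁′ := (near Λ₀^{(j)} r(Lʲε))′` once `L(R_n + 1) − 1 ≤ 3n`, `n < r(Lʲε)` ((2.8) collars)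
      ∀ (Rn : ℕ), ρ + 1 ≤ (Rn : ℝ) → (∀ μ : Fin P.d, 2 * (2 * Rn + 1) ≤ P.sitesPerDir (j + 1) μ) →
      ∀ (n : ℕ), (n : ℝ) < rad j → (P.L : ℝ) * ((Rn : ℝ) + 1) - 1 ≤ 3 * (n : ℝ) →
      -- a charge datum on `ℝ^d`, the step's vector field `A′`, and the letters of (2.55)
      ∀ (C₀ : ChargeData P.d) (A' : HiggsLattice.VecField P (j + 1)) {c₁ pℓ tA tPhi : ℝ}, 0 ≤ c₁ → 0 ≤ pℓ → 0 ≤ tPhi →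
      -- `δA` is at least the (2.60) bound read off (2.55)₁,₂, and small in the two printed scalings
      ∀ {δA : ℝ}, ((P.L : ℝ) ^ (j + 1))⁻¹ * (CV * P.d * (P.mesh (j + 1) * (c₁ * pℓ)) + CF * Real.exp (-(δ * ρ₁)) * (c₁ * tA * pℓ)) ≤ δA →
          (P.L : ℝ) ^ (j + 1) * δA * |C.e| ≤ t →
        ∀ {ec : ℝ}, 0 < ec → ec ≤ e₁ → (P.L : ℝ) ^ (j + 1) * P.mesh (j + 1) * |C.e| * δA ≤ creg * ec ^ β →
      -- `x ∈ Bᵏ(ȳ)` with `ȳ` the centre of `□₁` and at least `m` inside `□₂` in every direction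
      ∀ (x : HiggsLattice.Site P 0),
        (∀ ν : Fin P.d, m ≤ ((blockIter (j + 1) x) ν - q ν).val ∧ ((blockIter (j + 1) x) ν - q ν).val + m < Sbox) →
        (∀ ν : Fin P.d, ((blockIter (j + 1) x) ν - q₁ ν).val = R₁) →
      -- THE RESTRICTIONS (2.55) on `Λ₋₁` for the fields `A′, φ` of the step and the background `A^{(k)} = a_kζ^{(k)}G_kQ_k^*A′` — all four conjuncts used
      ∀ (φ : HiggsLattice.ScalarField P (j + 1) N),
        Restr255 C c₁ pℓ tA tPhi (j + 1) (prime (near (towerRegion bad rad j 0) (rad j))) A' φ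
          (ofSite (cutMin C₀ mu0sq aV (j + 1) ζ (toSite A'))) →
        ‖bgScalar256 C msq a (j + 1) (prime (towerRegion bad rad j 2)) (prime (towerRegion bad rad j 6))
              (ofSite (cutMin C₀ mu0sq aV (j + 1) ζ (toSite A'))) φ x
            - avgQkAdj C (ofSite (cutMin C₀ mu0sq aV (j + 1) ζ (toSite A'))) (j + 1) φ x‖
          ≤ B1.aSeq a P.L (j + 1) * (c₁ * tPhi * pℓ) *
                (C₁ * Real.exp (-(1 / (4 * M) * (m : ℝ)))
                  + C₂ * Real.exp (-(1 / (4 * M) * ((R₁ : ℝ) + 1))))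
            + (D₁ * P.mesh (j + 1) ^ 2 *
                (B1.aSeq a P.L (j + 1) * (P.mesh (j + 1))⁻¹ ^ 2 * (|C.e| * (δA * (P.d * ((P.L : ℝ) ^ (j + 1) * Sbox))) * P.mesh 0 * (P.d * ((P.L : ℝ) ^ (j + 1) - 1))) * (c₁ * tPhi * pℓ)
                  + |C.e| * (δA * (P.d * ((P.L : ℝ) ^ (j + 1) * Sbox))) * (P.d * ((B1.aSeq a P.L (j + 1) * (P.mesh (j + 1))⁻¹ ^ 2 * (c₁ * tPhi * pℓ) * D₄ * P.mesh (j + 1)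
                        + |C.e| * (δA * (P.d * ((P.L : ℝ) ^ (j + 1) * Sbox))) * (B1.aSeq a P.L (j + 1) * D₃ * (c₁ * tPhi * pℓ))) + |C.e| * (δA * (P.d * ((P.L : ℝ) ^ (j + 1) * Sbox))) * (B1.aSeq a P.L (j + 1) * D₃ * (c₁ * tPhi * pℓ))))
                  + B1.aSeq a P.L (j + 1) * (P.mesh (j + 1))⁻¹ ^ 2 *
                      ((2 * (|C.e| * (δA * (P.d * ((P.L : ℝ) ^ (j + 1) * Sbox))) * P.mesh 0 * (P.d * ((P.L : ℝ) ^ (j + 1) - 1)))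
                        + (|C.e| * (δA * (P.d * ((P.L : ℝ) ^ (j + 1) * Sbox))) * P.mesh 0 * (P.d * ((P.L : ℝ) ^ (j + 1) - 1))) ^ 2) * (B1.aSeq a P.L (j + 1) * D₃ * (c₁ * tPhi * pℓ))))
              + D₂ * P.mesh (j + 1) * (|C.e| * (δA * (P.d * ((P.L : ℝ) ^ (j + 1) * Sbox))) * (B1.aSeq a P.L (j + 1) * D₃ * (c₁ * tPhi * pℓ))))
            + B1.aSeq a P.L (j + 1) * C₃ *
                (4 * M * ((P.mesh (j + 1) * (c₁ * pℓ) + P.mesh (j + 1) * |C.e| * (δA * (P.d * ((P.L : ℝ) ^ (j + 1) * Sbox))) * (c₁ * tPhi * pℓ)) * P.d)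
                  + Real.exp (-(1 / (4 * M) * ((R₁ : ℝ) + 1))) * (c₁ * tPhi * pℓ))
            + msq * P.mesh (j + 1) ^ 2 / (B1.aSeq a P.L (j + 1) + msq * P.mesh (j + 1) ^ 2) * (c₁ * tPhi * pℓ)
            + |C.e| * P.mesh 0 * (P.d * ((P.L : ℝ) ^ (j + 1) - 1)) * (δA * (P.d * ((P.L : ℝ) ^ (j + 1) * Sbox))) * (c₁ * tPhi * pℓ) := by
  obtain ⟨δ, CV, CF, hδ, hCV, hCF, K₀min, h⟩ := eq265_higgs_region_tails d L hd hL ha hmsq haV hmu0 N C ε₀ creg β hcreg hβ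
  refine ⟨δ, CV, CF, hδ, hCV, hCF, K₀min, fun M hM => ?_⟩
  obtain ⟨e₁, t, he₁, ht, C₁, C₂, C₃, D₁, D₂, D₃, D₄, hC₁, hC₂, hC₃, hD₁, hD₂, hD₃, hD₄, h⟩ := h M hM
  refine ⟨e₁, t, he₁, ht, C₁, C₂, C₃, D₁, D₂, D₃, D₄, hC₁, hC₂, hC₃, hD₁, hD₂, hD₃, hD₄, ?_⟩
  intro P S hPd hPL hPM j hjK h3 hε h1 bad rad hrad sq₂ sq₁ Sfin q Sbox hs2 h16 hbox hSbox hsq₂ h2S q₁ R₁ m hR₁m hRm hsq₁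
    ζ ρ ρ₁ hρ₁ zeta_abs zeta_supp zeta_one zeta_lip Rn hRn hRn2 n hn hroom C₀ A' c₁ pℓ tA tPhi hc₁ hpℓ htPhi δA h60δ ht' ec hec hle
    hsmall x hmargin hcentre φ h255
  -- the tower supplies: `M ∣ M`, `Λ₆′ ⊆ Λ₂′`, `Bᵏ(Λ₂′)` a big-block union of cube size `M`, and the cube condition into `Λ₋₁′`
  have hdvd : M ∣ P.M := hPM ▸ dvd_refl _
  have h62 : prime (towerRegion bad rad j 6) ⊆ prime (towerRegion bad rad j 2) := prime_towerRegion_six_subset_two bad hrad.le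
  have hΩ : IsBigBlockUnion (j + 1) M (underRegion (j + 1) (prime (towerRegion bad rad j 2))) :=
    hPM ▸ isBigBlockUnion_towerRegion_prime bad rad j 2
  have hjK' : j < P.K := hjK
  have hcube : ∀ y ∈ prime (towerRegion bad rad j 2), ∀ y' : HiggsLattice.Site P (j + 1),
      HiggsLattice.Site.tdist y y' ≤ Rn → y' ∈ prime (near (towerRegion bad rad j 0) (rad j)) := by
    intro y hy y' hyy'
    have hx : blockIter (j + 1) (toFinest y) ∈ prime (towerRegion bad rad j 2) := by rwa [blockIter_toFinest hjK]
    have hd' : (HiggsLattice.Site.tdist (blockIter (j + 1) (toFinest y)) y' : ℝ) ≤ ((Rn : ℝ) - 1) + 1 := by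
      rw [blockIter_toFinest hjK]; linarith [show (HiggsLattice.Site.tdist y y' : ℝ) ≤ Rn by exact_mod_cast hyy']
    have hroom' : (P.L : ℝ) * (((Rn : ℝ) - 1) + 2) - 1 ≤ 3 * (n : ℝ) := by linarith
    exact nbhd_towerRegion hjK' hrad.le hn hroom' (toFinest y) y' hx hd'
  exact h P S hPd hPL hdvd (Nat.succ_le_succ (Nat.zero_le j)) hjK h3 hε h1 _ _ sq₂ sq₁ Sfin q Sbox h62 hs2 h16 hΩ hbox hSbox hsq₂
    h2S q₁ R₁ m hR₁m hRm hsq₁ _ ζ ρ ρ₁ hρ₁ zeta_abs zeta_supp zeta_one zeta_lip Rn hRn hRn2 hcube C₀ A' hc₁ hpℓ htPhi h60δ ht' hec hle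
    hsmall x hmargin hcentre φ h255


/-- **(2.65) FOR PRINT'S OWN REGIONS AND PRINT'S OWN THRESHOLDS**: `eq265_higgs_tower` under the typer's `Restr255Printed C c₁ b₀ p μ₀ λ ℓ`
((2.55) p.570 «|(∂A)(b)| ≦ c₁p(L^{k−1}ε), |A(x)| ≦ (c₁/(μ₀L^{k−1}ε))p(L^{k−1}ε), |(D_{Ā^{(k)}}φ)(b)| ≦ c₁p(L^{k−1}ε), |φ(x)| ≦
(c₁/λ(L^{k−1}ε)^{1/4})p(L^{k−1}ε) for x ∈ Λ₋₁^{(k−1)′}, b ⊂ Λ₋₁^{(k−1)′}»; `p(ℓ) = B2.pFn b₀ p ℓ` (2.2), `λ(ℓ) = B2LargeField.lambdaEps λ ℓ d` (2.5);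
`ℓ ↤ L^{k−1}ε` free with `0 < ℓ ≤ 1`, `b₀ ≥ 0`, `λ > 0`): the letters `{c₁ pℓ t_A tPhi}` ↦ `{c₁ b₀ p μ₀ λ ℓ}`, `pℓ ↦ p(ℓ)`, `t_A ↦ 1/(μ₀ℓ)`,
`tPhi ↦ 1/λ(ℓ)^{1/4}` at every occurrence. [cite: Balaban1982Higgs2, Lemma 2.4 (2.65) p.572] [cite: Balaban1982Higgs2, (2.55) p.570, (2.56) p.570, (2.7)–(2.8) p.558] -/
theorem eq265_higgs_tower_printed (d L : ℕ) (hd : 1 ≤ d) (hL : Odd L ∧ 1 < L) {a : ℝ} (ha : 0 < a) {msq : ℝ} (hmsq : 0 < msq)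
    {aV : ℝ} (haV : 0 < aV) {mu0sq : ℝ} (hmu0 : 0 < mu0sq)
    (N : ℕ) (C : ChargeData N) (ε₀ : ℝ) (creg β : ℝ) (hcreg : 0 ≤ creg) (hβ : 0 < β) :
    ∃ δ CV CF : ℝ, 0 < δ ∧ 0 < CV ∧ 0 < CF ∧
    ∃ Mmin : ℕ, ∀ M : ℕ, Mmin ≤ M → ∃ e₁ t : ℝ, 0 < e₁ ∧ 0 < t ∧
      ∃ C₁ C₂ C₃ D₁ D₂ D₃ D₄ : ℝ, 0 ≤ C₁ ∧ 0 ≤ C₂ ∧ 0 ≤ C₃ ∧ 0 ≤ D₁ ∧ 0 ≤ D₂ ∧ 0 ≤ D₃ ∧ 0 ≤ D₄ ∧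
      ∀ (P : HiggsLattice.Params) (_ : Shape P), P.d = d → P.L = L → P.M = M →
      ∀ {j : ℕ}, j + 1 ≤ P.K → (∀ μ, 3 * half P (j + 1) M ≤ P.sitesPerDir 0 μ) → P.mesh (j + 1) ≤ ε₀ → P.mesh (j + 1) ≤ 1 →
      -- PRINT'S OWN REGIONS: the (2.7)–(2.8)/(2.43) tower of step `j`, primed to `T^{(k)}`, `k = j + 1`; `Λ₂′ ⊇ □₂`, `Λ₆′ ⊇ □₁`
      ∀ (bad : (l : ℕ) → Set (HiggsLattice.Site P l)) (rad : ℕ → ℝ), 0 < rad j →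
      ∀ (sq₂ sq₁ : Finset (HiggsLattice.Site P (j + 1))) (S : Fin P.d → Finset ℕ) (q : HiggsLattice.Site P (j + 1)) (Sbox : ℕ),
        sq₂ ⊆ prime (towerRegion bad rad j 2) → sq₁ ⊆ prime (towerRegion bad rad j 6) →
        underRegion (j + 1) sq₂ = cellBox (j + 1) M S →
        (∀ μ : Fin P.d, P.L ^ (j + 1) * Sbox < P.sitesPerDir 0 μ) →
      -- `□₂` IS the box `q + [0,S)ᵈ` of coarse sites, `□ = B^k(□₂)` smaller than half the torus
        (∀ y : HiggsLattice.Site P (j + 1), y ∈ sq₂ ↔ ∀ ν : Fin P.d, (y ν - q ν).val < Sbox) →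
        (∀ μ : Fin P.d, 2 * (P.L ^ (j + 1) * Sbox) ≤ P.sitesPerDir 0 μ) →
      -- `□₁` is the box of coarse sites of radius `R₁` (corner `q₁`); `m ≥ R₁` a coarse margin with `Lᵏm ≥` the depth radius
      ∀ (q₁ : HiggsLattice.Site P (j + 1)) (R₁ m : ℕ), R₁ ≤ m → 2 * rS P (j + 1) M + 2 * half P (j + 1) M * (P.d + 1) + 1 ≤ P.L ^ (j + 1) * m →
        (∀ y : HiggsLattice.Site P (j + 1), y ∈ sq₁ ↔ ∀ ν : Fin P.d, (y ν - q₁ ν).val < 2 * R₁ + 1) →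
      -- the cutoff `ζ^{(k)}` of (2.44)
      ∀ (ζ : HiggsLattice.Site P 0 → HiggsLattice.Site P (j + 1) → ℝ) (ρ ρ₁ : ℝ), 0 ≤ ρ₁ →
        (∀ x y', |ζ x y'| ≤ 1) →
        (∀ x y', ζ x y' ≠ 0 → (HiggsLattice.Site.tdist (blockIter (j + 1) x) y' : ℝ) ≤ ρ) →
        (∀ x y', (HiggsLattice.Site.tdist (blockIter (j + 1) x) y' : ℝ) ≤ ρ₁ → ζ x y' = 1) →
        (∀ (x : HiggsLattice.Site P 0) (ν : Fin P.d) (y' : HiggsLattice.Site P (j + 1)), |ζ (x.shift ν) y' - ζ x y'| ≤ ((P.L : ℝ) ^ (j + 1))⁻¹) →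
      -- the cube of radius `R_n ≥ ρ + 1` about `y ∈ Λ₂′` lies in `Λ₋₁′ := (near Λ₀^{(j)} r(Lʲε))′` once `L(R_n + 1) − 1 ≤ 3n`, `n < r(Lʲε)` ((2.8) collars)
      ∀ (Rn : ℕ), ρ + 1 ≤ (Rn : ℝ) → (∀ μ : Fin P.d, 2 * (2 * Rn + 1) ≤ P.sitesPerDir (j + 1) μ) →
      ∀ (n : ℕ), (n : ℝ) < rad j → (P.L : ℝ) * ((Rn : ℝ) + 1) - 1 ≤ 3 * (n : ℝ) →
      -- a charge datum on `ℝ^d`, the step's vector field `A′`, and the letters of (2.55)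
      ∀ (C₀ : ChargeData P.d) (A' : HiggsLattice.VecField P (j + 1)) {c₁ b₀ p μ₀ lam ℓ : ℝ}, 0 ≤ c₁ → 0 ≤ b₀ → 0 < lam → 0 < ℓ → ℓ ≤ 1 →
      -- `δA` is at least the (2.60) bound read off (2.55)₁,₂, and small in the two printed scalings
      ∀ {δA : ℝ}, ((P.L : ℝ) ^ (j + 1))⁻¹ * (CV * P.d * (P.mesh (j + 1) * (c₁ * B2.pFn b₀ p ℓ)) + CF * Real.exp (-(δ * ρ₁)) * (c₁ * (1 / (μ₀ * ℓ)) * B2.pFn b₀ p ℓ)) ≤ δA →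
          (P.L : ℝ) ^ (j + 1) * δA * |C.e| ≤ t →
        ∀ {ec : ℝ}, 0 < ec → ec ≤ e₁ → (P.L : ℝ) ^ (j + 1) * P.mesh (j + 1) * |C.e| * δA ≤ creg * ec ^ β →
      -- `x ∈ Bᵏ(ȳ)` with `ȳ` the centre of `□₁` and at least `m` inside `□₂` in every direction
      ∀ (x : HiggsLattice.Site P 0),
        (∀ ν : Fin P.d, m ≤ ((blockIter (j + 1) x) ν - q ν).val ∧ ((blockIter (j + 1) x) ν - q ν).val + m < Sbox) →
        (∀ ν : Fin P.d, ((blockIter (j + 1) x) ν - q₁ ν).val = R₁) →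
      -- THE RESTRICTIONS (2.55) on `Λ₋₁` for the fields `A′, φ` of the step and the background `A^{(k)} = a_kζ^{(k)}G_kQ_k^*A′` — all four conjuncts used
      ∀ (φ : HiggsLattice.ScalarField P (j + 1) N),
        Restr255Printed C c₁ b₀ p μ₀ lam ℓ (j + 1) (prime (near (towerRegion bad rad j 0) (rad j))) A' φ
          (ofSite (cutMin C₀ mu0sq aV (j + 1) ζ (toSite A'))) →
        ‖bgScalar256 C msq a (j + 1) (prime (towerRegion bad rad j 2)) (prime (towerRegion bad rad j 6))
              (ofSite (cutMin C₀ mu0sq aV (j + 1) ζ (toSite A'))) φ x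
            - avgQkAdj C (ofSite (cutMin C₀ mu0sq aV (j + 1) ζ (toSite A'))) (j + 1) φ x‖
          ≤ B1.aSeq a P.L (j + 1) * (c₁ * (1 / (B2LargeField.lambdaEps lam ℓ P.d) ^ (1 / 4 : ℝ)) * B2.pFn b₀ p ℓ) *
                (C₁ * Real.exp (-(1 / (4 * M) * (m : ℝ)))
                  + C₂ * Real.exp (-(1 / (4 * M) * ((R₁ : ℝ) + 1))))
            + (D₁ * P.mesh (j + 1) ^ 2 *
                (B1.aSeq a P.L (j + 1) * (P.mesh (j + 1))⁻¹ ^ 2 * (|C.e| * (δA * (P.d * ((P.L : ℝ) ^ (j + 1) * Sbox))) * P.mesh 0 * (P.d * ((P.L : ℝ) ^ (j + 1) - 1))) * (c₁ * (1 / (B2LargeField.lambdaEps lam ℓ P.d) ^ (1 / 4 : ℝ)) * B2.pFn b₀ p ℓ)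
                  + |C.e| * (δA * (P.d * ((P.L : ℝ) ^ (j + 1) * Sbox))) * (P.d * ((B1.aSeq a P.L (j + 1) * (P.mesh (j + 1))⁻¹ ^ 2 * (c₁ * (1 / (B2LargeField.lambdaEps lam ℓ P.d) ^ (1 / 4 : ℝ)) * B2.pFn b₀ p ℓ) * D₄ * P.mesh (j + 1)
                        + |C.e| * (δA * (P.d * ((P.L : ℝ) ^ (j + 1) * Sbox))) * (B1.aSeq a P.L (j + 1) * D₃ * (c₁ * (1 / (B2LargeField.lambdaEps lam ℓ P.d) ^ (1 / 4 : ℝ)) * B2.pFn b₀ p ℓ))) + |C.e| * (δA * (P.d * ((P.L : ℝ) ^ (j + 1) * Sbox))) * (B1.aSeq a P.L (j + 1) * D₃ * (c₁ * (1 / (B2LargeField.lambdaEps lam ℓ P.d) ^ (1 / 4 : ℝ)) * B2.pFn b₀ p ℓ))))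
                  + B1.aSeq a P.L (j + 1) * (P.mesh (j + 1))⁻¹ ^ 2 *
                      ((2 * (|C.e| * (δA * (P.d * ((P.L : ℝ) ^ (j + 1) * Sbox))) * P.mesh 0 * (P.d * ((P.L : ℝ) ^ (j + 1) - 1)))
                        + (|C.e| * (δA * (P.d * ((P.L : ℝ) ^ (j + 1) * Sbox))) * P.mesh 0 * (P.d * ((P.L : ℝ) ^ (j + 1) - 1))) ^ 2) * (B1.aSeq a P.L (j + 1) * D₃ * (c₁ * (1 / (B2LargeField.lambdaEps lam ℓ P.d) ^ (1 / 4 : ℝ)) * B2.pFn b₀ p ℓ))))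
              + D₂ * P.mesh (j + 1) * (|C.e| * (δA * (P.d * ((P.L : ℝ) ^ (j + 1) * Sbox))) * (B1.aSeq a P.L (j + 1) * D₃ * (c₁ * (1 / (B2LargeField.lambdaEps lam ℓ P.d) ^ (1 / 4 : ℝ)) * B2.pFn b₀ p ℓ))))
            + B1.aSeq a P.L (j + 1) * C₃ *
                (4 * M * ((P.mesh (j + 1) * (c₁ * B2.pFn b₀ p ℓ) + P.mesh (j + 1) * |C.e| * (δA * (P.d * ((P.L : ℝ) ^ (j + 1) * Sbox))) * (c₁ * (1 / (B2LargeField.lambdaEps lam ℓ P.d) ^ (1 / 4 : ℝ)) * B2.pFn b₀ p ℓ)) * P.d)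
                  + Real.exp (-(1 / (4 * M) * ((R₁ : ℝ) + 1))) * (c₁ * (1 / (B2LargeField.lambdaEps lam ℓ P.d) ^ (1 / 4 : ℝ)) * B2.pFn b₀ p ℓ))
            + msq * P.mesh (j + 1) ^ 2 / (B1.aSeq a P.L (j + 1) + msq * P.mesh (j + 1) ^ 2) * (c₁ * (1 / (B2LargeField.lambdaEps lam ℓ P.d) ^ (1 / 4 : ℝ)) * B2.pFn b₀ p ℓ)
            + |C.e| * P.mesh 0 * (P.d * ((P.L : ℝ) ^ (j + 1) - 1)) * (δA * (P.d * ((P.L : ℝ) ^ (j + 1) * Sbox))) * (c₁ * (1 / (B2LargeField.lambdaEps lam ℓ P.d) ^ (1 / 4 : ℝ)) * B2.pFn b₀ p ℓ) := by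
  obtain ⟨δ, CV, CF, hδ, hCV, hCF, Mmin, h⟩ := eq265_higgs_tower d L hd hL ha hmsq haV hmu0 N C ε₀ creg β hcreg hβ
  refine ⟨δ, CV, CF, hδ, hCV, hCF, Mmin, fun M hM => ?_⟩
  obtain ⟨e₁, t, he₁, ht, C₁, C₂, C₃, D₁, D₂, D₃, D₄, hC₁, hC₂, hC₃, hD₁, hD₂, hD₃, hD₄, h⟩ := h M hM
  refine ⟨e₁, t, he₁, ht, C₁, C₂, C₃, D₁, D₂, D₃, D₄, hC₁, hC₂, hC₃, hD₁, hD₂, hD₃, hD₄, ?_⟩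
  intro P S hPd hPL hPM j hjK h3 hε h1 bad rad hrad sq₂ sq₁ Sfin q Sbox hs2 h16 hbox hSbox hsq₂ h2S q₁ R₁ m hR₁m hRm hsq₁
    ζ ρ ρ₁ hρ₁ zeta_abs zeta_supp zeta_one zeta_lip Rn hRn hRn2 n hn hroom C₀ A' c₁ b₀ p μ₀ lam ℓ hc₁ hb₀ hlam hℓ hℓ1 δA h60δ ht'
    ec hec hle hsmall x hmargin hcentre φ h255
  -- the signs of the printed thresholds
  have hlog : 0 ≤ 1 + Real.log ℓ⁻¹ := by
    have := Real.log_nonneg ((one_le_inv₀ hℓ).mpr hℓ1)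
    linarith
  have hpℓ : 0 ≤ B2.pFn b₀ p ℓ := by
    unfold B2.pFn
    exact mul_nonneg hb₀ (Real.rpow_nonneg hlog p)
  have htPhi : 0 ≤ 1 / (B2LargeField.lambdaEps lam ℓ P.d) ^ (1 / 4 : ℝ) :=
    div_nonneg zero_le_one (Real.rpow_nonneg (B2LargeField.lambdaEps_pos hlam hℓ P.d).le _)
  have h255' : Restr255 C c₁ (B2.pFn b₀ p ℓ) (1 / (μ₀ * ℓ)) (1 / (B2LargeField.lambdaEps lam ℓ P.d) ^ (1 / 4 : ℝ)) (j + 1)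
      (prime (near (towerRegion bad rad j 0) (rad j))) A' φ (ofSite (cutMin C₀ mu0sq aV (j + 1) ζ (toSite A'))) := h255
  exact h P S hPd hPL hPM hjK h3 hε h1 bad rad hrad sq₂ sq₁ Sfin q Sbox hs2 h16 hbox hSbox hsq₂ h2S q₁ R₁ m hR₁m hRm hsq₁ ζ ρ ρ₁ hρ₁
    zeta_abs zeta_supp zeta_one zeta_lip Rn hRn hRn2 n hn hroom C₀ A' hc₁ hpℓ htPhi h60δ ht' hec hle hsmall x hmargin hcentre φ h255'

end Tower

end Literature.MathematicalPhysics.QuantumFieldTheory.Balaban1983to89.B2Eq265HiggsTower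

end
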